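import Literature.MathematicalPhysics.QuantumLattice.SectorGroundProjContinuity
import Literature.MathematicalPhysics.QuantumLattice.HubbardRingPerronFrobeniusProofs
import Literature.MathematicalPhysics.QuantumLattice.FermionGammaFunctor
import HarnessLib

/-!
# Crux `SgEndpoint` (stmt-HubbardSuperconductivity-16272, route `ColourTheSpin`), line `birth`:
# spin descent to the `S^z = 0` sector at the top of an invariant pair form

Support file 1/2 for the registered stub S3 `stub_pureGaugeDictionary` (file 2:
`ColourTheSpinSgEndpointStubPureGaugeDictionary`). Abstract linear algebra on the fermionic Fock
space `Fock (Orb Λ)`: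

* `forall_orth_of_isMaxOn` — **first variation**: if `Re ⟨v, R v⟩ ≤ r ‖v‖²` on a subspace `W`
  (`R` Hermitian) and `w ∈ W` attains the bound, then `⟨x, R w⟩ = r ⟨x, w⟩` for all `x ∈ W`
  (expand `Re ⟨w + t x, (r - R)(w + t x)⟩ ≥ 0` at `t = -s ⟨x, (r - R) w⟩`, `s ↓ 0`);
* `exists_isInSector_of_rayleigh` — **spin descent**: for Hermitian `H`, `R` preserving the
  coordinate sectors `(N↑, N↓)` and commuting with `S⁺`, `S⁻`, a nonzero `2n`-particle
  `e`-eigenvector `v` of `H` with `r ‖v‖² ≤ Re ⟨v, R v⟩` yields a nonzero vector of the sector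
  `(n, n)` (`S^z = 0`) in the same eigenspace with the same bound. Proof: maximise `Re ⟨x, R x⟩`
  on the unit sphere of `W = {2n-particle e-eigenvectors}` (compact); by the first variation
  `(R - r⋆) x⋆ ⊥ W`, a property stable under the sector projections (both `H`, `R` preserve
  sectors) and under `S^∓` (adjoint to each other, commuting with `H`, `R`), and carrying the
  exact Rayleigh value `r⋆ ≥ r`; a nonzero sector component is then lowered by the injective `S⁻`
  (resp. raised by `S⁺`) inside coordinate sectors (Lieb 1989) down to `(n, n)`;
* bookkeeping: adjoints in `dotProduct` form, particle-number preservation of `Γ(g)` and of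
  spin-raising/lowering matrices, self-adjointness of `sectorProj`.

Sources: E. H. Lieb, PRL 62 (1989) 1201, proof of Theorem 1 (sectors, the `S^±` ladder, "all
competitors have a representative there"); H. Tasaki (2020) §2.2, §9.3. All folklore.
-/

noncomputable section

namespace Summit.HubbardSuperconductivity.ColourTheSpin.SgEndpoint

open Matrix Finset Literature.MathematicalPhysics.QuantumLattice Literature.Probability.LatticeModels
open scoped ComplexOrder

/-! ### Linear algebra: adjoints, `N`-particle bookkeeping -/

section LinAlg

variable {ι : Type*} [Fintype ι]

/-- `⟨z, M w⟩ = ⟨Mᴴ z, w⟩`. [folklore] -/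
theorem star_dotProduct_mulVec_eq_adj (M : Matrix ι ι ℂ) (z w : ι → ℂ) :
    star z ⬝ᵥ M *ᵥ w = star (Mᴴ *ᵥ z) ⬝ᵥ w := by
  rw [star_mulVec, conjTranspose_conjTranspose, ← dotProduct_mulVec]

/-- For a unitary `F` (`Fᴴ F = 1`), `⟨F v, F w⟩ = ⟨v, w⟩`. [folklore] -/
theorem star_mulVec_dotProduct_mulVec_of_unitary [DecidableEq ι] {F : Matrix ι ι ℂ}
    (hF : Fᴴ * F = 1) (v w : ι → ℂ) : star (F *ᵥ v) ⬝ᵥ F *ᵥ w = star v ⬝ᵥ w := by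
  rw [star_mulVec, ← dotProduct_mulVec, mulVec_mulVec, hF, one_mulVec]

/-- `⟨v, (Fᴴ X F) v⟩ = ⟨F v, X (F v)⟩`. [folklore] -/
theorem star_dotProduct_conj_mulVec (F X : Matrix ι ι ℂ) (v : ι → ℂ) :
    star v ⬝ᵥ (Fᴴ * X * F) *ᵥ v = star (F *ᵥ v) ⬝ᵥ X *ᵥ (F *ᵥ v) := by
  rw [star_mulVec, ← dotProduct_mulVec, mulVec_mulVec, mulVec_mulVec, Matrix.mul_assoc]

end LinAlg

section NParticle

variable {ι : Type*} [LinearOrder ι] [Fintype ι]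

omit [LinearOrder ι] [Fintype ι] in
/-- A matrix with no entries between occupation configurations of different cardinality maps
`N`-particle vectors to `N`-particle vectors. [folklore] -/
theorem isNParticle_mulVec_of_card_eq [Fintype (Finset ι)] {M : Matrix (Finset ι) (Finset ι) ℂ}
    (hM : ∀ s t, M s t ≠ 0 → s.card = t.card) {N : ℕ} {ψ : Fock ι} (hψ : IsNParticle N ψ) :
    IsNParticle N (M *ᵥ ψ) := by
  intro s hs
  rw [mulVec, dotProduct]
  refine Finset.sum_eq_zero fun t _ => ?_
  by_cases h : M s t = 0
  · rw [h, zero_mul]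
  · rw [hψ t (by rw [← hM s t h]; exact hs), mul_zero]

/-- The second quantisation `Γ(g)` preserves the particle number. [folklore] -/
theorem isNParticle_Gamma_mulVec (g : Matrix ι ι ℂ) {N : ℕ} {ψ : Fock ι} (hψ : IsNParticle N ψ) :
    IsNParticle N (Gamma g *ᵥ ψ) :=
  isNParticle_mulVec_of_card_eq (fun s t h => by
    by_contra hst
    exact h (Gamma_apply_of_card_ne g hst)) hψ

end NParticle

/-! ### The first variation at a maximiser of a Hermitian form on a subspace -/

section Variation

variable {ι : Type*} [Fintype ι]

/-- **First variation.** If `Re ⟨v, R v⟩ ≤ r ‖v‖²` on a subspace `W` (`R` Hermitian) and `w ∈ W`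
attains the bound, then `(R - r) w ⊥ W`: `⟨x, R w⟩ = r ⟨x, w⟩` for all `x ∈ W` (expand
`Re ⟨w + t x, (r - R)(w + t x)⟩ ≥ 0` in `t`). [folklore] -/
theorem forall_orth_of_isMaxOn {R : Matrix ι ι ℂ} (hR : Rᴴ = R) (W : Submodule ℂ (ι → ℂ)) {r : ℝ}
    (hle : ∀ v ∈ W, (star v ⬝ᵥ R *ᵥ v).re ≤ r * (star v ⬝ᵥ v).re) {w : ι → ℂ} (hwW : w ∈ W)
    (hw : r * (star w ⬝ᵥ w).re ≤ (star w ⬝ᵥ R *ᵥ w).re) :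
    ∀ x ∈ W, star x ⬝ᵥ R *ᵥ w = (r : ℂ) * (star x ⬝ᵥ w) := by
  intro x hx
  -- the form `B v v' = ⟨v, (r - R) v'⟩`, nonnegative on `W`, vanishing at `w`
  set T : (ι → ℂ) → (ι → ℂ) := fun v => (r : ℂ) • v - R *ᵥ v with hT
  have hre : ∀ v v' : ι → ℂ, (star v ⬝ᵥ T v').re =
      r * (star v ⬝ᵥ v').re - (star v ⬝ᵥ R *ᵥ v').re := by
    intro v v'
    simp only [hT, dotProduct_sub, dotProduct_smul, smul_eq_mul, Complex.sub_re,
      Complex.re_ofReal_mul]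
  have hTpos : ∀ v ∈ W, 0 ≤ (star v ⬝ᵥ T v).re := fun v hv => by rw [hre]; linarith [hle v hv]
  have hTw : (star w ⬝ᵥ T w).re ≤ 0 := by rw [hre]; linarith
  have hTsa : ∀ v v' : ι → ℂ, star v ⬝ᵥ T v' = star (star v' ⬝ᵥ T v) := by
    intro v v'
    simp only [hT, dotProduct_sub, dotProduct_smul, smul_eq_mul, star_sub, star_mul',
      Complex.star_def, Complex.conj_ofReal]
    rw [EigenvalueContinuation.star_dotProduct_mulVec_comm hR v v', star_dotProduct v v']
    rfl
  have hTadd : ∀ v v', T (v + v') = T v + T v' := by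
    intro v v'
    simp only [hT, mulVec_add, smul_add]
    abel
  have hTsmul : ∀ (c : ℂ) (v), T (c • v) = c • T v := by
    intro c v
    simp only [hT, mulVec_smul, smul_sub, smul_comm c (r : ℂ) v]
  -- `z = ⟨x, T w⟩`; expand the form at `w + t x`, `t = -s z`, `s` real
  set z : ℂ := star x ⬝ᵥ T w with hz
  have hzw : star w ⬝ᵥ T x = star z := by rw [hz, hTsa]
  set c : ℝ := (star x ⬝ᵥ T x).re with hc
  have hc0 : 0 ≤ c := hTpos x hx
  have hexpC : ∀ t : ℂ, star (w + t • x) ⬝ᵥ T (w + t • x) =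
      star w ⬝ᵥ T w + t * star z + star t * z + star t * t * (star x ⬝ᵥ T x) := by
    intro t
    simp only [hTadd, hTsmul, star_add, star_smul, add_dotProduct, dotProduct_add, smul_dotProduct,
      dotProduct_smul, smul_eq_mul]
    rw [← hz, hzw]
    ring
  have hzz : star z * z = ((‖z‖ ^ 2 : ℝ) : ℂ) := by
    rw [Complex.star_def, mul_comm, Complex.mul_conj, Complex.normSq_eq_norm_sq]
  have hexp : ∀ s : ℝ, (star (w + ((-(s : ℂ)) * z) • x) ⬝ᵥ T (w + ((-(s : ℂ)) * z) • x)).re =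
      (star w ⬝ᵥ T w).re - 2 * s * ‖z‖ ^ 2 + s ^ 2 * ‖z‖ ^ 2 * c := by
    intro s
    rw [hexpC]
    have hst : star (-(s : ℂ) * z) = -(s : ℂ) * star z := by
      rw [star_mul', star_neg, Complex.star_def, Complex.conj_ofReal, ← Complex.star_def]
    have ht1 : -(s : ℂ) * z * star z = (((-(s * ‖z‖ ^ 2)) : ℝ) : ℂ) := by
      rw [mul_assoc, mul_comm z, hzz]; push_cast; ring
    have ht2 : star (-(s : ℂ) * z) * z = (((-(s * ‖z‖ ^ 2)) : ℝ) : ℂ) := by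
      rw [hst, mul_assoc, hzz]; push_cast; ring
    have ht3 : star (-(s : ℂ) * z) * (-(s : ℂ) * z) = (((s ^ 2 * ‖z‖ ^ 2) : ℝ) : ℂ) := by
      rw [hst, show -(s : ℂ) * star z * (-(s : ℂ) * z) = (s : ℂ) * (s : ℂ) * (star z * z) by ring,
        hzz]; push_cast; ring
    rw [ht1, ht2, ht3]
    simp only [Complex.add_re, Complex.ofReal_re, Complex.re_ofReal_mul]
    rw [← hc]
    ring
  have hmem : ∀ s : ℝ, w + ((-(s : ℂ)) * z) • x ∈ W := fun s =>
    W.add_mem hwW (W.smul_mem _ hx)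
  -- take `s = 1 / (c + 1)`
  have key := hTpos _ (hmem (1 / (c + 1)))
  rw [hexp] at key
  have hc1 : (0 : ℝ) < c + 1 := by linarith
  have hz0 : ‖z‖ ^ 2 = 0 := by
    by_contra hne
    have hpos : 0 < ‖z‖ ^ 2 := lt_of_le_of_ne (by positivity) (Ne.symm hne)
    have h1 : (star w ⬝ᵥ T w).re - 2 * (1 / (c + 1)) * ‖z‖ ^ 2 + (1 / (c + 1)) ^ 2 * ‖z‖ ^ 2 * c
        = (star w ⬝ᵥ T w).re - ‖z‖ ^ 2 * (c + 2) / (c + 1) ^ 2 := by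
      field_simp
      ring
    rw [h1] at key
    have h3 : 0 < ‖z‖ ^ 2 * (c + 2) / (c + 1) ^ 2 := by positivity
    linarith
  have hz00 : z = 0 := by
    have : ‖z‖ = 0 := pow_eq_zero_iff (n := 2) (by norm_num) |>.1 hz0
    exact norm_eq_zero.1 this
  -- `⟨x, T w⟩ = 0` is the claim
  have h := hz00
  rw [hz, hT] at h
  simp only [dotProduct_sub, dotProduct_smul, smul_eq_mul] at h
  exact (sub_eq_zero.1 h).symm

end Variation

/-! ### Spin descent to the `S^z = 0` sector at the top of an invariant pair form -/

section Descent

variable {Λ : Type*} [LinearOrder Λ] [Fintype Λ]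

/-- The coordinate-sector projection is self-adjoint: `⟨z, P_{ab} w⟩ = ⟨P_{ab} z, w⟩`. [folklore] -/
theorem star_dotProduct_sectorProj (a b : ℕ) (z w : Fock (Orb Λ)) :
    star z ⬝ᵥ sectorProj a b w = star (sectorProj a b z) ⬝ᵥ w := by
  simp only [dotProduct, Pi.star_apply, sectorProj_apply]
  refine Finset.sum_congr rfl fun s _ => ?_
  split_ifs <;> simp

/-- The coordinate-sector projection of an `N`-particle vector is an `N`-particle vector.
[folklore] -/
theorem isNParticle_sectorProj_of_isNParticle {N : ℕ} {ψ : Fock (Orb Λ)} (hψ : IsNParticle N ψ)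
    (a b : ℕ) : IsNParticle N (sectorProj a b ψ) := fun s hs => by
  rw [sectorProj_apply, hψ s hs, ite_self]

/-- A spin-raising or spin-lowering matrix preserves the particle number. [folklore] -/
theorem card_eq_of_raises_or_lowers {M : Matrix (Finset (Orb Λ)) (Finset (Orb Λ)) ℂ}
    (hM : RaisesSpin M ∨ LowersSpin M) (s t : Finset (Orb Λ)) (hst : M s t ≠ 0) :
    s.card = t.card := by
  rw [card_eq_upPart_add_downPart, card_eq_upPart_add_downPart]
  rcases hM with hM | hM
  · have h := hM s t hst; omega
  · have h := hM s t hst; omega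

/-- **Spin descent at the top of an invariant form.** Let `H`, `R` be Hermitian matrices on the
Fock space which preserve the coordinate sectors `(N↑, N↓)` and commute with `S⁺` and `S⁻`.
If a nonzero `2n`-particle eigenvector `v` of `H` (eigenvalue `e`) has `r ‖v‖² ≤ Re ⟨v, R v⟩`,
then so does a nonzero vector of the coordinate sector `(n, n)` (`S^z = 0`) in the same
eigenspace. (Maximise `Re ⟨x, R x⟩` over the unit `2n`-particle `e`-eigenvectors; the first
variation `(R - r⋆) x⋆ ⊥` passes to sector components and along the mutually adjoint `S^∓`;
lower with the injective `S⁻` / raise with `S⁺` inside coordinate sectors.)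
Lieb, PRL 62 (1989) 1201, proof of Theorem 1; Tasaki (2020) §2.2, §9.3. [folklore] -/
theorem exists_isInSector_of_rayleigh
    (H R : Matrix (Finset (Orb Λ)) (Finset (Orb Λ)) ℂ) (hR : R.IsHermitian)
    (hHs : PreservesSectors H) (hRs : PreservesSectors R)
    (hHP : Commute H spinPlus) (hHM : Commute H spinMinus)
    (hRP : Commute R spinPlus) (hRM : Commute R spinMinus)
    (n : ℕ) (e r : ℝ) {v : Fock (Orb Λ)} (hvN : IsNParticle (2 * n) v) (hv0 : v ≠ 0)
    (hHv : H *ᵥ v = (e : ℂ) • v) (hrv : r * (star v ⬝ᵥ v).re ≤ (star v ⬝ᵥ R *ᵥ v).re) :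
    ∃ u : Fock (Orb Λ), IsInSector n n u ∧ u ≠ 0 ∧ H *ᵥ u = (e : ℂ) • u ∧
      r * (star u ⬝ᵥ u).re ≤ (star u ⬝ᵥ R *ᵥ u).re := by
  classical
  -- the subspace `W` of `2n`-particle `e`-eigenvectors of `H`
  let W : Submodule ℂ (Fock (Orb Λ)) :=
    nParticleSubmodule (2 * n) ⊓ Module.End.eigenspace (Matrix.toLin' H) (e : ℂ)
  have hW : ∀ y, y ∈ W ↔ IsNParticle (2 * n) y ∧ H *ᵥ y = (e : ℂ) • y := fun y => by
    rw [mem_inf_eigenspace_toLin'_iff, mem_nParticleSubmodule_iff]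
  have hvW : v ∈ W := (hW v).2 ⟨hvN, hHv⟩
  -- a maximiser of `Re ⟨x, R x⟩` on the unit sphere of `W`
  obtain ⟨c₀, -, -, hc₀⟩ := EigenvalueContinuation.exists_normalize hv0
  have hCne : ({w | w ∈ W ∧ star w ⬝ᵥ w = 1} : Set (Fock (Orb Λ))).Nonempty :=
    ⟨_, W.smul_mem _ hvW, hc₀⟩
  obtain ⟨x, hxC, hmax⟩ := (EigenvalueContinuation.isCompact_unitSphere_inter W).exists_isMaxOn
    hCne (EigenvalueContinuation.continuous_energy R).continuousOn
  set rs : ℝ := (star x ⬝ᵥ R *ᵥ x).re with hrs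
  -- `Re ⟨y, R y⟩ ≤ rs ‖y‖²` on `W`
  have hle : ∀ y ∈ W, (star y ⬝ᵥ R *ᵥ y).re ≤ rs * (star y ⬝ᵥ y).re := by
    intro y hy
    by_cases hy0 : y = 0
    · simp [hy0]
    obtain ⟨c, -, hcc, h1⟩ := EigenvalueContinuation.exists_normalize hy0
    have h2 : (star ((c : ℂ) • y) ⬝ᵥ R *ᵥ ((c : ℂ) • y)).re ≤ rs := hmax ⟨W.smul_mem (c : ℂ) hy, h1⟩
    rw [mulVec_smul, EigenvalueContinuation.star_real_smul_dotProduct_real_smul,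
      Complex.re_ofReal_mul] at h2
    have hpos := EigenvalueContinuation.re_star_dotProduct_self_pos hy0
    calc (star y ⬝ᵥ R *ᵥ y).re
        = (star y ⬝ᵥ R *ᵥ y).re * (c * c * (star y ⬝ᵥ y).re) := by rw [hcc, mul_one]
      _ = c * c * (star y ⬝ᵥ R *ᵥ y).re * (star y ⬝ᵥ y).re := by ring
      _ ≤ rs * (star y ⬝ᵥ y).re := mul_le_mul_of_nonneg_right h2 hpos.le
  have hr : r ≤ rs :=
    le_of_mul_le_mul_right (hrv.trans (hle v hvW)) (EigenvalueContinuation.re_star_dotProduct_self_pos hv0)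
  -- the top multiplet `T`: vectors of `W` with `(R - rs) y ⊥ W`
  let InT : Fock (Orb Λ) → Prop := fun y =>
    y ∈ W ∧ ∀ z ∈ W, star z ⬝ᵥ R *ᵥ y = (rs : ℂ) * (star z ⬝ᵥ y)
  have hxT : InT x :=
    ⟨hxC.1, forall_orth_of_isMaxOn hR.eq W hle hxC.1 (le_of_eq (by rw [hxC.2, Complex.one_re, mul_one]))⟩
  have hTval : ∀ y, InT y → (star y ⬝ᵥ R *ᵥ y).re = rs * (star y ⬝ᵥ y).re := fun y hy => by
    rw [hy.2 y hy.1, Complex.re_ofReal_mul]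
  -- `W` is invariant under the sector projections and under `S^±`
  have hWproj : ∀ y ∈ W, ∀ a b, sectorProj a b y ∈ W := by
    intro y hy a b
    rw [hW] at hy ⊢
    refine ⟨isNParticle_sectorProj_of_isNParticle hy.1 a b, ?_⟩
    rw [hHs.mulVec_sectorProj, hy.2, sectorProj_smul]
  have hWM : ∀ y ∈ W, spinMinus *ᵥ y ∈ W := by
    intro y hy
    rw [hW] at hy ⊢
    refine ⟨isNParticle_mulVec_of_card_eq
      (card_eq_of_raises_or_lowers (Or.inr LiebThm1.lowersSpin_spinMinus)) hy.1, ?_⟩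
    rw [mulVec_mulVec, hHM.eq, ← mulVec_mulVec, hy.2, mulVec_smul]
  have hWP : ∀ y ∈ W, spinPlus *ᵥ y ∈ W := by
    intro y hy
    rw [hW] at hy ⊢
    refine ⟨isNParticle_mulVec_of_card_eq
      (card_eq_of_raises_or_lowers (Or.inl LiebThm1.raisesSpin_spinPlus)) hy.1, ?_⟩
    rw [mulVec_mulVec, hHP.eq, ← mulVec_mulVec, hy.2, mulVec_smul]
  have hMadj : (spinMinus : Matrix (Finset (Orb Λ)) (Finset (Orb Λ)) ℂ)ᴴ = spinPlus := by
    rw [spinMinus, conjTranspose_conjTranspose]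
  have hPadj : (spinPlus : Matrix (Finset (Orb Λ)) (Finset (Orb Λ)) ℂ)ᴴ = spinMinus := rfl
  -- `T` is invariant under the sector projections and under `S^±`
  have hTproj : ∀ y, InT y → ∀ a b, InT (sectorProj a b y) := by
    intro y hy a b
    refine ⟨hWproj y hy.1 a b, fun z hz => ?_⟩
    rw [hRs.mulVec_sectorProj, star_dotProduct_sectorProj a b z (R *ᵥ y), hy.2 _ (hWproj z hz a b),
      star_dotProduct_sectorProj a b z y]
  have hTM : ∀ y, InT y → InT (spinMinus *ᵥ y) := by
    intro y hy
    refine ⟨hWM y hy.1, fun z hz => ?_⟩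
    rw [mulVec_mulVec, hRM.eq, ← mulVec_mulVec, star_dotProduct_mulVec_eq_adj spinMinus z (R *ᵥ y),
      hMadj, hy.2 _ (hWP z hz), star_dotProduct_mulVec_eq_adj spinMinus z y, hMadj]
  have hTP : ∀ y, InT y → InT (spinPlus *ᵥ y) := by
    intro y hy
    refine ⟨hWP y hy.1, fun z hz => ?_⟩
    rw [mulVec_mulVec, hRP.eq, ← mulVec_mulVec, star_dotProduct_mulVec_eq_adj spinPlus z (R *ᵥ y),
      hPadj, hy.2 _ (hWM z hz), star_dotProduct_mulVec_eq_adj spinPlus z y, hPadj]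
  -- descent with `S⁻` from the sectors `(b + 2k, b)` and with `S⁺` from `(a, a + 2k)`
  have descM : ∀ k b : ℕ, ∀ y, IsInSector (b + 2 * k) b y → InT y → y ≠ 0 →
      ∃ u, IsInSector (b + k) (b + k) u ∧ InT u ∧ u ≠ 0 := by
    intro k
    induction k with
    | zero =>
      intro b y hy hT h0
      exact ⟨y, by simpa using hy, hT, h0⟩
    | succ k ih =>
      intro b y hy hT h0
      have hy' : IsInSector (b + 2 * k + 1 + 1) b y := by
        rwa [show b + 2 * (k + 1) = b + 2 * k + 1 + 1 by ring] at hy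
      have hsec : IsInSector (b + 1 + 2 * k) (b + 1) (spinMinus *ᵥ y) := by
        have h := LiebThm1.lowersSpin_spinMinus.isInSector_mulVec hy'
        rwa [show b + 2 * k + 1 = b + 1 + 2 * k by ring] at h
      have hne : spinMinus *ᵥ y ≠ 0 := fun h =>
        h0 (LiebThm1.eq_zero_of_spinMinus_mulVec_eq_zero (by omega) hy h)
      obtain ⟨u, hu, hTu, hu0⟩ := ih (b + 1) _ hsec (hTM y hT) hne
      exact ⟨u, by rwa [show b + (k + 1) = b + 1 + k by ring], hTu, hu0⟩
  have descP : ∀ k a : ℕ, ∀ y, IsInSector a (a + 2 * k) y → InT y → y ≠ 0 →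
      ∃ u, IsInSector (a + k) (a + k) u ∧ InT u ∧ u ≠ 0 := by
    intro k
    induction k with
    | zero =>
      intro a y hy hT h0
      exact ⟨y, by simpa using hy, hT, h0⟩
    | succ k ih =>
      intro a y hy hT h0
      have hy' : IsInSector a (a + 2 * k + 1 + 1) y := by
        rwa [show a + 2 * (k + 1) = a + 2 * k + 1 + 1 by ring] at hy
      have hsec : IsInSector (a + 1) (a + 1 + 2 * k) (spinPlus *ᵥ y) := by
        have h := LiebThm1.raisesSpin_spinPlus.isInSector_mulVec hy'
        rwa [show a + 2 * k + 1 = a + 1 + 2 * k by ring] at h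
      have hne : spinPlus *ᵥ y ≠ 0 := fun h =>
        h0 (LiebThm1.eq_zero_of_spinPlus_mulVec_eq_zero (by omega) hy h)
      obtain ⟨u, hu, hTu, hu0⟩ := ih (a + 1) _ hsec (hTP y hT) hne
      exact ⟨u, by rwa [show a + (k + 1) = a + 1 + k by ring], hTu, hu0⟩
  -- a nonzero sector component of the maximiser
  have hx0 : x ≠ 0 := by
    rintro rfl
    have h := hxC.2
    simp at h
  have hxN : IsNParticle (2 * n) x := ((hW x).1 hxC.1).1
  have hsum := sum_sectorProj_eq hxN
  obtain ⟨a, ha, hne⟩ : ∃ a ∈ range (2 * n + 1), sectorProj a (2 * n - a) x ≠ 0 := by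
    by_contra hall
    push Not at hall
    exact hx0 (by rw [← hsum]; exact Finset.sum_eq_zero hall)
  obtain ⟨b, hb⟩ : ∃ b, b = 2 * n - a := ⟨_, rfl⟩
  rw [← hb] at hne
  have ha' : a < 2 * n + 1 := mem_range.1 ha
  have hTw : InT (sectorProj a b x) := hTproj x hxT a b
  have hwsec : IsInSector a b (sectorProj a b x) := isInSector_sectorProj a b x
  -- descend to `(n, n)`
  obtain ⟨u, hu, hTu, hu0⟩ : ∃ u, IsInSector n n u ∧ InT u ∧ u ≠ 0 := by
    rcases le_or_gt b a with hab | hab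
    · obtain ⟨k, hk⟩ : ∃ k, a = b + 2 * k := ⟨n - b, by omega⟩
      have hkn : b + k = n := by omega
      subst hk
      obtain ⟨u, hu, hTu, hu0⟩ := descM k b _ hwsec hTw hne
      exact ⟨u, by rwa [hkn] at hu, hTu, hu0⟩
    · obtain ⟨k, hk⟩ : ∃ k, b = a + 2 * k := ⟨n - a, by omega⟩
      have hkn : a + k = n := by omega
      subst hk
      obtain ⟨u, hu, hTu, hu0⟩ := descP k a _ hwsec hTw hne
      exact ⟨u, by rwa [hkn] at hu, hTu, hu0⟩
  refine ⟨u, hu, hu0, ((hW u).1 hTu.1).2, ?_⟩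
  calc r * (star u ⬝ᵥ u).re ≤ rs * (star u ⬝ᵥ u).re :=
        mul_le_mul_of_nonneg_right hr (EigenvalueContinuation.re_star_dotProduct_self_nonneg u)
    _ = (star u ⬝ᵥ R *ᵥ u).re := (hTval u hTu).symm

/-- **Registered helper form** of `exists_isInSector_of_rayleigh` (all binders after the colon; the
sub-goal of stub S3 `stub_pureGaugeDictionary` proved in this file): spin descent to the coordinate
sector `(n, n)` inside an eigenspace, at the top of an invariant pair form. [folklore] -/
theorem helper_spinDescent : ∀ {Λ : Type*} [LinearOrder Λ] [Fintype Λ] (H R : Matrix (Finset (Orb Λ)) (Finset (Orb Λ)) ℂ), R.IsHermitian → PreservesSectors H → PreservesSectors R → Commute H spinPlus → Commute H spinMinus → Commute R spinPlus → Commute R spinMinus → ∀ (n : ℕ) (e r : ℝ) (v : Fock (Orb Λ)), IsNParticle (2 * n) v → v ≠ 0 → H *ᵥ v = (e : ℂ) • v → r * (star v ⬝ᵥ v).re ≤ (star v ⬝ᵥ R *ᵥ v).re → ∃ u : Fock (Orb Λ), IsInSector n n u ∧ u ≠ 0 ∧ H *ᵥ u = (e : ℂ) • u ∧ r * (star u ⬝ᵥ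 u).re ≤ (star u ⬝ᵥ R *ᵥ u).re :=
  fun H R hR hHs hRs hHP hHM hRP hRM n e r _ hvN hv0 hHv hrv =>
    exists_isInSector_of_rayleigh H R hR hHs hRs hHP hHM hRP hRM n e r hvN hv0 hHv hrv

end Descent

end Summit.HubbardSuperconductivity.ColourTheSpin.SgEndpoint

end
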